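import Summits.ValiantsHypothesis.ValiantsHypothesis.Theorems.PolyaContinuedSignedCoverLittleEarA
import Literature.Combinatorics.SimpleGraph.PfaffianCertificate
import Mathlib.Algebra.BigOperators.Ring.Finset
import Mathlib.Algebra.Ring.Parity
import HarnessLib

/-!
# Route PolyaContinued — support item `SignedCoverLittle` (stmt-ValiantsHypothesis-7426):
# step (EVEN) — an odd, evenly covering family of directed circuits is intractable;
# the Case-B digraph is not Pfaffian

Section (EVEN) + certificate of the paper proof `proof-LabelTransfer.md` (§2) of the label-transfer
principle (to which the item was reduced in `…SignedCoverLittleReduction.lean`), typed against the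
Case-B interface exported by the ear lemma (`…SignedCoverLittleEarC.lean`, step (EAR)).

Setting of `PfaffianDicycles.lean` / `PfaffianCertificate.lean`: `G ⊆ Fin n × Fin n` contains the
diagonal (the reference perfect matching), a *directed circuit* of `D(G, M)` is a cyclic permutation
`γ` inside `G`, and `G` is Pfaffian iff some signing, `+1` on the diagonal, gives every directed
circuit the weight `sign γ * ∏ i, s (i, γ i) = 1` (`isPfaffianBipartite_iff_forall_isCycle`). The
tree's certificate `not_isPfaffianBipartite_of_certificate` asks for a list `F` of directed circuits
covering every off-diagonal cell an even number of times AND whose signs multiply to `-1`.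

* `countP_ne_self_eq_sum`, `even_countP_ne_self` — even ARC coverage implies even VERTEX coverage
  (a vertex `a` lies on `γ` iff `γ` has an arc `a → b`, `b ≠ a`);
* `sum_card_support_eq_sum_countP`, `prod_sign_eq_of_isCycle`,
  `prod_sign_eq_neg_one_of_even_cover` — for cyclic `γ`, `sign γ = -(-1) ^ #supp γ`, so the
  product of the signs of `F` is `(-1) ^ (|F| + Σ_γ #supp γ)`, and `Σ_γ #supp γ = Σ_a (vertex
  coverage of a)` is even under even arc coverage: **an odd evenly-covering family has sign
  product `-1`** — the second hypothesis of the certificate is automatic;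
* `not_isPfaffianBipartite_of_odd_even_cover` — hence `G ⊇ diagonal` carrying an ODD list of
  directed circuits that covers every off-diagonal cell an even number of times is not Pfaffian
  (Little's odd intractable set; this is the form (EVEN) uses: five circuits, coverages 4/2/2);
* `ite_caseB_apply_eq`, `sum_ite_mem_and_eq`, `countP_caseB` — arc-coverage bookkeeping of the
  CASE-B DIGRAPH `γ₊ ∪ γ₋` (two cyclic permutations `μ = γ₊`, `ν = γ₋`, three forks
  `p 0, p 1, p 2` met in opposite cyclic orders, and the three single-ear circuits
  `Z j = μ[p j → p (j+1)] · ν[p (j+1) → p j]` of `exists_splice_cycle`): every off-diagonal cell is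
  an arc of exactly twice as many members of `[μ, ν, Z 0, Z 1, Z 2]` as of `[μ, ν]`, i.e. of `0`,
  `2` or `4` of the five circuits;
* `disjoint_pathSet_of_agree`, `disjoint_pathSet_caseB` — the two paths spliced into a single-ear
  circuit are disjoint (derived from the other clauses of the (EAR) interface);
* `not_isPfaffianBipartite_of_caseB` (`…_of_caseB'` = interface form, disjointness derived) — **a
  graph `G ⊇ diagonal` inside which a Case-B digraph of five directed circuits lies is not
  Pfaffian.** In the closing argument `G = H₁` (the normalised
  preimage configuration), `μ, ν` the lifts of `δ₊, δ₋` and `Z` the single-ear circuits produced by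
  (EAR); this contradicts `H₁ ⊆ H` Pfaffian.

The Case-B data are consumed exactly in the shape of the (EAR) interface (`pathSet` of
`…SignedCoverLittleEarA.lean`; indices in `Fin 3`, `j + 1` taken in `Fin 3`); the disjointness of
the two spliced paths (the hypothesis of `exists_splice_cycle`) is either taken
(`not_isPfaffianBipartite_of_caseB`) or derived from the forks lying in both supports
(`not_isPfaffianBipartite_of_caseB'`).
-/

namespace Summit.ValiantsHypothesis.PolyaContinued

open Equiv Equiv.Perm Finset Literature.Combinatorics.SimpleGraph

/-! ### Even arc coverage ⇒ even vertex coverage ⇒ sign product of an odd family is `-1` -/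

section Generic

variable {n : ℕ}

/-- The number of members of `F` MOVING the vertex `a` is the sum over `b ≠ a` of the number of
members with the arc `a → b`. [folklore] -/
theorem countP_ne_self_eq_sum (F : List (Perm (Fin n))) (a : Fin n) :
    F.countP (fun γ => γ a ≠ a) = ∑ b ∈ Finset.univ.erase a, F.countP (fun γ => γ a = b) := by
  induction F with
  | nil => simp
  | cons γ F ih =>
    have hγ : (if γ a ≠ a then 1 else 0 : ℕ) =
        ∑ b ∈ Finset.univ.erase a, (if γ a = b then 1 else 0 : ℕ) := by
      by_cases h : γ a = a
      · rw [if_neg (not_not.2 h)]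
        symm
        refine Finset.sum_eq_zero fun b hb => ?_
        rw [if_neg]
        rw [h]
        exact (Finset.ne_of_mem_erase hb).symm
      · rw [if_pos h, Finset.sum_ite_eq, if_pos (Finset.mem_erase.2 ⟨h, Finset.mem_univ _⟩)]
    rw [List.countP_cons, ih]
    simp only [decide_eq_true_eq]
    rw [hγ, ← Finset.sum_add_distrib]
    refine Finset.sum_congr rfl fun b _ => ?_
    rw [List.countP_cons]
    simp only [decide_eq_true_eq]

/-- **Even arc coverage implies even vertex coverage**: if every off-diagonal cell `(a, b)` is an
arc of an even number of members of `F`, then every vertex is moved by an even number of members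
of `F`. [folklore] -/
theorem even_countP_ne_self (F : List (Perm (Fin n)))
    (heven : ∀ a b : Fin n, a ≠ b → Even (F.countP fun γ => γ a = b)) (a : Fin n) :
    Even (F.countP fun γ => γ a ≠ a) := by
  rw [countP_ne_self_eq_sum]
  exact Finset.even_sum _ fun b hb => heven a b (Finset.ne_of_mem_erase hb).symm

/-- Double counting: the total support size of the members of `F` is the total vertex coverage.
[folklore] -/
theorem sum_card_support_eq_sum_countP (F : List (Perm (Fin n))) :
    (F.map fun γ => γ.support.card).sum = ∑ a : Fin n, F.countP (fun γ => γ a ≠ a) := by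
  induction F with
  | nil => simp
  | cons γ F ih =>
    rw [List.map_cons, List.sum_cons, ih]
    have hγ : γ.support.card = ∑ a : Fin n, (if γ a ≠ a then 1 else 0 : ℕ) := by
      rw [Finset.sum_boole, Nat.cast_id]
      rfl
    rw [hγ, ← Finset.sum_add_distrib]
    refine Finset.sum_congr rfl fun a _ => ?_
    rw [List.countP_cons]
    simp only [decide_eq_true_eq]
    exact Nat.add_comm _ _

/-- The sign product of a list of CYCLIC permutations: `∏ sign γ = (-1) ^ (|F| + Σ_γ #supp γ)`
(each cyclic `γ` has `sign γ = -(-1) ^ #supp γ`, `Equiv.Perm.IsCycle.sign`). [folklore] -/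
theorem prod_sign_eq_of_isCycle (F : List (Perm (Fin n))) (hcyc : ∀ γ ∈ F, γ.IsCycle) :
    (F.map fun γ => (Perm.sign γ : ℤˣ)).prod =
      (-1) ^ (F.length + (F.map fun γ => γ.support.card).sum) := by
  induction F with
  | nil => simp
  | cons γ F ih =>
    rw [List.map_cons, List.prod_cons, ih fun γ' hγ' => hcyc γ' (List.mem_cons_of_mem _ hγ'),
      (hcyc γ List.mem_cons_self).sign, List.length_cons, List.map_cons, List.sum_cons]
    have h1 : -(-1 : ℤˣ) ^ γ.support.card = (-1) ^ (γ.support.card + 1) := by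
      rw [pow_succ, mul_neg_one]
    rw [h1, ← pow_add]
    congr 1
    omega

/-- **An odd, evenly covering family of directed circuits has sign product `-1`.** If the cyclic
permutations of the list `F` cover every off-diagonal cell an even number of times and `|F|` is
odd, then `∏_{γ ∈ F} sign γ = -1`: the total support size is the total vertex coverage, which is
even (`even_countP_ne_self`). [folklore] -/
theorem prod_sign_eq_neg_one_of_even_cover (F : List (Perm (Fin n)))
    (hcyc : ∀ γ ∈ F, γ.IsCycle)
    (heven : ∀ a b : Fin n, a ≠ b → Even (F.countP fun γ => γ a = b))
    (hodd : Odd F.length) :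
    (F.map fun γ => (Perm.sign γ : ℤˣ)).prod = -1 := by
  rw [prod_sign_eq_of_isCycle F hcyc]
  have hsum : Even (F.map fun γ => γ.support.card).sum := by
    rw [sum_card_support_eq_sum_countP]
    exact Finset.even_sum _ fun a _ => even_countP_ne_self F heven a
  exact (hodd.add_even hsum).neg_one_pow

/-- **Little's odd intractable set, diagonal reference matching.** Let `G ⊇ diagonal`, and let
`F` be a list of ODD length of cyclic permutations inside `G` (directed circuits of `D(G, M)`)
covering every off-diagonal cell an even number of times. Then `G` is not Pfaffian: the sign
product is `-1` (`prod_sign_eq_neg_one_of_even_cover`) and the tree's certificate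
`not_isPfaffianBipartite_of_certificate` applies. [folklore] -/
theorem not_isPfaffianBipartite_of_odd_even_cover {G : Finset (Fin n × Fin n)}
    (hdiag : ∀ i, (i, i) ∈ G) (F : List (Perm (Fin n))) (hcyc : ∀ γ ∈ F, γ.IsCycle)
    (hmem : ∀ γ ∈ F, ∀ i, (i, γ i) ∈ G)
    (heven : ∀ a b : Fin n, a ≠ b → Even (F.countP fun γ => γ a = b))
    (hodd : Odd F.length) : ¬ IsPfaffianBipartite G :=
  not_isPfaffianBipartite_of_certificate hdiag F hcyc hmem heven
    (prod_sign_eq_neg_one_of_even_cover F hcyc heven hodd)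

end Generic

/-! ### Arc coverage of the Case-B digraph -/

section CaseB

variable {α : Type*} [Fintype α] [DecidableEq α]

/-- One single-ear circuit `Z j = μ[p j → p (j+1)] · ν[p (j+1) → p j]`: for `a ≠ b`, the arc
`a → b` belongs to `Z j` iff it is an arc of `μ` with tail on the `μ`-path, or an arc of `ν` with
tail on the `ν`-path (the two paths being disjoint, at most one case occurs). [folklore] -/
theorem ite_caseB_apply_eq {μ ν : Perm α} {p : Fin 3 → α} {Z : Fin 3 → Perm α}
    (hZμ : ∀ j v, v ∈ pathSet μ (p j) (p (j + 1)) → Z j v = μ v)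
    (hZν : ∀ j v, v ∈ pathSet ν (p (j + 1)) (p j) → Z j v = ν v)
    (hZfix : ∀ j v, v ∉ pathSet μ (p j) (p (j + 1)) → v ∉ pathSet ν (p (j + 1)) (p j) → Z j v = v)
    (hdisj : ∀ j, Disjoint (pathSet μ (p j) (p (j + 1))) (pathSet ν (p (j + 1)) (p j)))
    (j : Fin 3) {a b : α} (hab : a ≠ b) :
    (if Z j a = b then 1 else 0 : ℕ) =
      (if a ∈ pathSet μ (p j) (p (j + 1)) ∧ μ a = b then 1 else 0) +
        (if a ∈ pathSet ν (p (j + 1)) (p j) ∧ ν a = b then 1 else 0) := by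
  by_cases hμa : a ∈ pathSet μ (p j) (p (j + 1))
  · have hνa : a ∉ pathSet ν (p (j + 1)) (p j) := Finset.disjoint_left.1 (hdisj j) hμa
    rw [hZμ j a hμa]
    by_cases h : μ a = b
    · rw [if_pos h, if_pos ⟨hμa, h⟩, if_neg fun h' => hνa h'.1]
    · rw [if_neg h, if_neg fun h' => h h'.2, if_neg fun h' => hνa h'.1]
  · by_cases hνa : a ∈ pathSet ν (p (j + 1)) (p j)
    · rw [hZν j a hνa]
      by_cases h : ν a = b
      · rw [if_pos h, if_neg fun h' => hμa h'.1, if_pos ⟨hνa, h⟩]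
      · rw [if_neg h, if_neg fun h' => hμa h'.1, if_neg fun h' => h h'.2]
    · rw [hZfix j a hμa hνa, if_neg hab, if_neg fun h' => hμa h'.1, if_neg fun h' => hνa h'.1]

/-- Summing over the three single-ear circuits: since every point of `supp μ` lies on exactly one
of the three `μ`-paths `A j`, the arc `a → b` of `μ` (`a ≠ b`, so `a ∈ supp μ`) is picked up by
exactly one of them. [folklore] -/
theorem sum_ite_mem_and_eq {μ : Perm α} (A : Fin 3 → Finset α)
    (hpart : ∀ v ∈ μ.support, ∃! j, v ∈ A j)
    {a b : α} (hab : a ≠ b) :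
    (∑ j : Fin 3, (if a ∈ A j ∧ μ a = b then 1 else 0 : ℕ)) = if μ a = b then 1 else 0 := by
  by_cases h : μ a = b
  · have ha : a ∈ μ.support := by
      rw [Perm.mem_support, h]
      exact hab.symm
    obtain ⟨j₀, hj₀, huniq⟩ := hpart a ha
    rw [if_pos h]
    have : ∀ j : Fin 3, (if a ∈ A j ∧ μ a = b then 1 else 0 : ℕ) = if j = j₀ then 1 else 0 := by
      intro j
      by_cases hj : j = j₀
      · rw [if_pos hj, if_pos ⟨hj ▸ hj₀, h⟩]
      · rw [if_neg hj, if_neg fun h' => hj (huniq j h'.1)]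
    rw [Finset.sum_congr rfl fun j _ => this j, Finset.sum_ite_eq' Finset.univ j₀,
      if_pos (Finset.mem_univ _)]
  · rw [if_neg h]
    exact Finset.sum_eq_zero fun j _ => if_neg fun h' => h h'.2

/-- **Arc coverage of the Case-B digraph.** With `μ = γ₊`, `ν = γ₋`, forks `p 0, p 1, p 2` and
single-ear circuits `Z j` following `μ` from `p j` to `p (j+1)` and `ν` from `p (j+1)` back to
`p j` (elsewhere fixed), the `μ`-paths partitioning `supp μ` and the `ν`-paths partitioning
`supp ν`: every off-diagonal cell `(a, b)` is an arc of exactly twice as many members of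
`[μ, ν, Z 0, Z 1, Z 2]` as of `[μ, ν]` — the arcs of the common paths `Sᵢ` lie on `4` of the five
circuits, the arcs of the ears `gᵢ`, `eᵢ` on `2`, all other cells on `0`. [folklore] -/
theorem countP_caseB (μ ν : Perm α) (p : Fin 3 → α) (Z : Fin 3 → Perm α)
    (hZμ : ∀ j v, v ∈ pathSet μ (p j) (p (j + 1)) → Z j v = μ v)
    (hZν : ∀ j v, v ∈ pathSet ν (p (j + 1)) (p j) → Z j v = ν v)
    (hZfix : ∀ j v, v ∉ pathSet μ (p j) (p (j + 1)) → v ∉ pathSet ν (p (j + 1)) (p j) → Z j v = v)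
    (hdisj : ∀ j, Disjoint (pathSet μ (p j) (p (j + 1))) (pathSet ν (p (j + 1)) (p j)))
    (hμpart : ∀ v ∈ μ.support, ∃! j, v ∈ pathSet μ (p j) (p (j + 1)))
    (hνpart : ∀ v ∈ ν.support, ∃! j, v ∈ pathSet ν (p (j + 1)) (p j))
    {a b : α} (hab : a ≠ b) :
    ([μ, ν, Z 0, Z 1, Z 2].countP fun γ => γ a = b) =
      2 * ([μ, ν].countP fun γ => γ a = b) := by
  -- both sides as sums of indicators
  have hL : ([μ, ν, Z 0, Z 1, Z 2].countP fun γ => γ a = b) =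
      (if μ a = b then 1 else 0) + (if ν a = b then 1 else 0) +
        ∑ j : Fin 3, (if Z j a = b then 1 else 0 : ℕ) := by
    rw [Fin.sum_univ_three]
    simp only [List.countP_cons, List.countP_nil, decide_eq_true_eq]
    omega
  have hR : ([μ, ν].countP fun γ => γ a = b) =
      (if μ a = b then 1 else 0) + (if ν a = b then 1 else 0 : ℕ) := by
    simp only [List.countP_cons, List.countP_nil, decide_eq_true_eq]
    omega
  have hZ : (∑ j : Fin 3, (if Z j a = b then 1 else 0 : ℕ)) =
      (if μ a = b then 1 else 0) + (if ν a = b then 1 else 0 : ℕ) := by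
    rw [Finset.sum_congr rfl fun j _ => ite_caseB_apply_eq hZμ hZν hZfix hdisj j hab,
      Finset.sum_add_distrib,
      sum_ite_mem_and_eq (fun j => pathSet μ (p j) (p (j + 1))) hμpart hab,
      sum_ite_mem_and_eq (fun j => pathSet ν (p (j + 1)) (p j)) hνpart hab]
  rw [hL, hR, hZ]
  omega

/-- **The two spliced paths are disjoint.** Let `μ, ν` be cyclic permutations and `p, q` points of
both supports. If `μ` and `ν` AGREE at every common tail of the `μ`-path from `p` to `q` and the
`ν`-path from `q` back to `p` (as they do when one permutation `Z` follows `μ` on the first and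
`ν` on the second), then the two paths have no tail in common: from a common tail furthest along
the `μ`-path, one more step stays on both paths (the `μ`-path cannot return to `p`, the `ν`-path
cannot return to `q` before their ends). [folklore] -/
theorem disjoint_pathSet_of_agree {μ ν : Perm α} (hμ : μ.IsCycle) (hν : ν.IsCycle) {p q : α}
    (hpμ : p ∈ μ.support) (hqμ : q ∈ μ.support) (hpν : p ∈ ν.support) (hqν : q ∈ ν.support)
    (hagree : ∀ v, v ∈ pathSet μ p q → v ∈ pathSet ν q p → μ v = ν v) :
    Disjoint (pathSet μ p q) (pathSet ν q p) := by
  classical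
  rw [Finset.disjoint_iff_inter_eq_empty]
  by_contra hne
  obtain ⟨v, hv, hmax⟩ := Finset.exists_max_image (pathSet μ p q ∩ pathSet ν q p)
    (fun w => cdist μ p w) (Finset.nonempty_iff_ne_empty.2 hne)
  obtain ⟨hvA, hvB⟩ := Finset.mem_inter.1 hv
  obtain ⟨hvμ, hltA⟩ := mem_pathSet.1 hvA
  obtain ⟨hvν, hltB⟩ := mem_pathSet.1 hvB
  have hv_eq : μ v = ν v := hagree v hvA hvB
  have hqo : cdist μ p q < orderOf μ := cdist_lt_orderOf hμ hpμ hqμ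
  have hpo : cdist ν q p < orderOf ν := cdist_lt_orderOf hν hqν hpν
  by_cases hμq : μ v = q
  · -- then `ν v = q`: `v` is the last point of the `ν`-circuit from `q`, not on the path to `p`
    have hlast : cdist ν q v + 1 = orderOf ν := cdist_succ_eq_orderOf hν hqν hvν (hv_eq ▸ hμq)
    omega
  · -- one more step along both paths
    have hμp : μ v ≠ p := by
      intro h
      have hlast : cdist μ p v + 1 = orderOf μ := cdist_succ_eq_orderOf hμ hpμ hvμ h
      omega
    have hA' : μ v ∈ pathSet μ p q := apply_mem_pathSet hμ hpμ hvA hμq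
    have hB' : μ v ∈ pathSet ν q p := by
      rw [hv_eq]
      exact apply_mem_pathSet hν hqν hvB (hv_eq ▸ hμp)
    have hle := hmax (μ v) (Finset.mem_inter.2 ⟨hA', hB'⟩)
    rw [cdist_apply_eq_succ hμ hpμ hvμ hμp] at hle
    omega

/-- In the Case-B configuration the disjointness of the two paths of each single-ear circuit
follows from the other clauses of the (EAR) interface (`Z j` agrees with `μ` on one path and with
`ν` on the other), the forks lying in both supports. [folklore] -/
theorem disjoint_pathSet_caseB {μ ν : Perm α} (hμ : μ.IsCycle) (hν : ν.IsCycle) {p : Fin 3 → α}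
    {Z : Fin 3 → Perm α} (hpμ : ∀ j, p j ∈ μ.support) (hpν : ∀ j, p j ∈ ν.support)
    (hZμ : ∀ j v, v ∈ pathSet μ (p j) (p (j + 1)) → Z j v = μ v)
    (hZν : ∀ j v, v ∈ pathSet ν (p (j + 1)) (p j) → Z j v = ν v) (j : Fin 3) :
    Disjoint (pathSet μ (p j) (p (j + 1))) (pathSet ν (p (j + 1)) (p j)) :=
  disjoint_pathSet_of_agree hμ hν (hpμ j) (hpμ (j + 1)) (hpν j) (hpν (j + 1))
    fun v hA hB => (hZμ j v hA).symm.trans (hZν j v hB)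

end CaseB

/-! ### The Case-B digraph is not Pfaffian -/

section Conclusion

variable {n : ℕ}

/-- **(EVEN): a graph inside which a Case-B digraph lies is not Pfaffian.** Let `G ⊇ diagonal`
(`G ⊆ Fin n × Fin n`) contain the cells of two cyclic permutations `μ = γ₊`, `ν = γ₋` and of the
three single-ear circuits `Z 0, Z 1, Z 2` of a Case-B configuration (forks `p j`; `Z j` follows
`μ` on the `μ`-path `p j → p (j+1)`, `ν` on the `ν`-path `p (j+1) → p j`, disjoint paths, fixes the
rest; the three `μ`-paths partition `supp μ` and the three `ν`-paths partition `supp ν`). Then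
the five directed circuits cover every off-diagonal cell `0`, `2` or `4` times (`countP_caseB`),
five is odd, so `G` is not Pfaffian (`not_isPfaffianBipartite_of_odd_even_cover`: no signing
makes all five circuits positive, the product of their weights being the product of their signs
`= -1`). In the proof of the label-transfer principle `G = H₁ ⊆ H`, contradicting `H` Pfaffian.
[folklore] -/
theorem not_isPfaffianBipartite_of_caseB {G : Finset (Fin n × Fin n)} (hdiag : ∀ i, (i, i) ∈ G)
    {μ ν : Perm (Fin n)} (hμ : μ.IsCycle) (hν : ν.IsCycle) (hμG : ∀ i, (i, μ i) ∈ G)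
    (hνG : ∀ i, (i, ν i) ∈ G) (p : Fin 3 → Fin n) (Z : Fin 3 → Perm (Fin n))
    (hZc : ∀ j, (Z j).IsCycle) (hZG : ∀ j i, (i, Z j i) ∈ G)
    (hZμ : ∀ j v, v ∈ pathSet μ (p j) (p (j + 1)) → Z j v = μ v)
    (hZν : ∀ j v, v ∈ pathSet ν (p (j + 1)) (p j) → Z j v = ν v)
    (hZfix : ∀ j v, v ∉ pathSet μ (p j) (p (j + 1)) → v ∉ pathSet ν (p (j + 1)) (p j) → Z j v = v)
    (hdisj : ∀ j, Disjoint (pathSet μ (p j) (p (j + 1))) (pathSet ν (p (j + 1)) (p j)))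
    (hμpart : ∀ v ∈ μ.support, ∃! j, v ∈ pathSet μ (p j) (p (j + 1)))
    (hνpart : ∀ v ∈ ν.support, ∃! j, v ∈ pathSet ν (p (j + 1)) (p j)) :
    ¬ IsPfaffianBipartite G := by
  refine not_isPfaffianBipartite_of_odd_even_cover hdiag [μ, ν, Z 0, Z 1, Z 2] ?_ ?_ ?_ ?_
  · intro γ hγ
    simp only [List.mem_cons, List.not_mem_nil, or_false] at hγ
    rcases hγ with rfl | rfl | rfl | rfl | rfl
    exacts [hμ, hν, hZc 0, hZc 1, hZc 2]
  · intro γ hγ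
    simp only [List.mem_cons, List.not_mem_nil, or_false] at hγ
    rcases hγ with rfl | rfl | rfl | rfl | rfl
    exacts [hμG, hνG, hZG 0, hZG 1, hZG 2]
  · intro a b hab
    rw [countP_caseB μ ν p Z hZμ hZν hZfix hdisj hμpart hνpart hab]
    exact even_two_mul _
  · exact ⟨2, rfl⟩

/-- **(EVEN), interface form.** The same with the disjointness of the spliced paths DERIVED
(`disjoint_pathSet_caseB`) from the forks lying in both supports — exactly the data of the (EAR)
interface `ear_caseB` (`p j ∈ forks μ ν ⊆ supp μ ∩ supp ν`). [folklore] -/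
theorem not_isPfaffianBipartite_of_caseB' {G : Finset (Fin n × Fin n)} (hdiag : ∀ i, (i, i) ∈ G)
    {μ ν : Perm (Fin n)} (hμ : μ.IsCycle) (hν : ν.IsCycle) (hμG : ∀ i, (i, μ i) ∈ G)
    (hνG : ∀ i, (i, ν i) ∈ G) (p : Fin 3 → Fin n) (Z : Fin 3 → Perm (Fin n))
    (hpμ : ∀ j, p j ∈ μ.support) (hpν : ∀ j, p j ∈ ν.support)
    (hZc : ∀ j, (Z j).IsCycle) (hZG : ∀ j i, (i, Z j i) ∈ G)
    (hZμ : ∀ j v, v ∈ pathSet μ (p j) (p (j + 1)) → Z j v = μ v)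
    (hZν : ∀ j v, v ∈ pathSet ν (p (j + 1)) (p j) → Z j v = ν v)
    (hZfix : ∀ j v, v ∉ pathSet μ (p j) (p (j + 1)) → v ∉ pathSet ν (p (j + 1)) (p j) → Z j v = v)
    (hμpart : ∀ v ∈ μ.support, ∃! j, v ∈ pathSet μ (p j) (p (j + 1)))
    (hνpart : ∀ v ∈ ν.support, ∃! j, v ∈ pathSet ν (p (j + 1)) (p j)) :
    ¬ IsPfaffianBipartite G :=
  not_isPfaffianBipartite_of_caseB hdiag hμ hν hμG hνG p Z hZc hZG hZμ hZν hZfix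
    (disjoint_pathSet_caseB hμ hν hpμ hpν hZμ hZν) hμpart hνpart

end Conclusion

end Summit.ValiantsHypothesis.PolyaContinued
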